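import Summits.Ventures.CertifiedManyBodySolver.Observables.StructureFactorsSumRules

/-!
# The certificate-free range of the real-space density correlator `C_c(r; ψ)`

HONEST FRAMING: first certified bounds; not a superconductivity verdict; every number certified or
labelled float.

Companion to `StructureFactorsSumRules` / `SpinCorrelatorRange`.  For any two orbital sites `x, y`
(`n_x = n_{x↑} + n_{x↓}`, `d_x = n_{x↑} n_{x↓}`, all commuting, `n_x² = n_x + 2 d_x`):
* `(2 - n_x - n_y)² ⪰ 0` gives **`2 n_x n_y ⪰ 3(n_x + n_y) - 4 - 2(d_x + d_y)`**;
* `(n_x - n_y)² ⪰ 0` gives **`2 n_x n_y ≤ n_x + n_y + 2(d_x + d_y)`**.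
Summed over the torus (`y = x + r`, any displacement `r`): `3𝒩 - 4L²‖ψ‖² - 2𝒟 ≤ Re⟨ψ, N_r ψ⟩ ≤ 𝒩 + 2𝒟`
hence on a unit `N`-particle vector **`(3N - 2𝒟)/L² - 2 ≤ C_c(r; ψ) ≤ (N + 2𝒟)/L²`**
(`densityCorr_mem_Icc_of_isNParticle`).  With the certified docc window of the `4 × 4`, `N = 14`,
`t′ = 0` torus (`𝒟 ≤ 1.0367`) this is `C_c ∈ [0.495, 1.005]` per site (float evaluation; the
inequalities are exact) — the "kinematic range" column of stripe_defs §5bis for the `C̄_c(R)` classes,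
replacing the bare `[0, n + 2d]`.
-/

namespace Summit.Ventures.CertifiedManyBodySolver.Observables

open Matrix Literature.MathematicalPhysics.QuantumLattice Literature.Probability.LatticeModels
open Literature.MathematicalPhysics.QuantumLattice.HubbardWave0
open Literature.MathematicalPhysics.QuantumLattice.FermionTorus
open scoped BigOperators ComplexConjugate ComplexOrder

section TwoSite

variable (L : ℕ)

/-- `(c·1 + εₓ n_x + ε_y n_y)` is Hermitian for real coefficients (helper). -/
private theorem conjTranspose_lin (c εx εy : ℝ) (x y : FermionTorus 2 L) :
    ((c : ℂ) • (1 : Matrix (Finset (Orb (FermionTorus 2 L))) (Finset (Orb (FermionTorus 2 L))) ℂ) + (εx : ℂ) • siteDensity x +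
        (εy : ℂ) • siteDensity y)ᴴ =
      (c : ℂ) • (1 : Matrix (Finset (Orb (FermionTorus 2 L))) (Finset (Orb (FermionTorus 2 L))) ℂ) + (εx : ℂ) • siteDensity x +
        (εy : ℂ) • siteDensity y := by
  rw [conjTranspose_add, conjTranspose_add, conjTranspose_smul, conjTranspose_smul, conjTranspose_smul,
    conjTranspose_one, conjTranspose_siteDensity, conjTranspose_siteDensity]
  simp only [Complex.star_def, Complex.conj_ofReal]

/-- The square of `c·1 + εₓ n_x + ε_y n_y`, expanded with `n² = n + 2d` and `[n_x, n_y] = 0`. -/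
private theorem lin_mul_lin (c εx εy : ℂ) (x y : FermionTorus 2 L) :
    (c • (1 : Matrix (Finset (Orb (FermionTorus 2 L))) (Finset (Orb (FermionTorus 2 L))) ℂ) + εx • siteDensity x + εy • siteDensity y) *
        (c • (1 : Matrix (Finset (Orb (FermionTorus 2 L))) (Finset (Orb (FermionTorus 2 L))) ℂ) + εx • siteDensity x + εy • siteDensity y) =
      (c * c) • (1 : Matrix (Finset (Orb (FermionTorus 2 L))) (Finset (Orb (FermionTorus 2 L))) ℂ) + (2 * c * εx + εx * εx) • siteDensity x +
        (2 * c * εy + εy * εy) • siteDensity y +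
        (2 * εx * εx) • (numberOp x 0 * numberOp x 1 : Matrix (Finset (Orb (FermionTorus 2 L))) (Finset (Orb (FermionTorus 2 L))) ℂ) +
        (2 * εy * εy) • (numberOp y 0 * numberOp y 1 : Matrix (Finset (Orb (FermionTorus 2 L))) (Finset (Orb (FermionTorus 2 L))) ℂ) +
        (2 * εx * εy) • (siteDensity x * siteDensity y) := by
  have hc : siteDensity y * siteDensity x = siteDensity x * siteDensity y := (siteDensity_commute y x).eq
  simp only [add_mul, mul_add, smul_mul_assoc, mul_smul_comm, one_mul, mul_one, siteDensity_mul_self, hc,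
    smul_add, smul_smul]
  module

/-- **Lower two-site bound** `4·1 - 3(n_x + n_y) + 2(d_x + d_y) + 2 n_x n_y = (2 - n_x - n_y)² ⪰ 0`. -/
theorem posSemidef_two_sub_siteDensity_sq (x y : FermionTorus 2 L) :
    ((4 : ℂ) • (1 : Matrix (Finset (Orb (FermionTorus 2 L))) (Finset (Orb (FermionTorus 2 L))) ℂ) - (3 : ℂ) • (siteDensity x + siteDensity y) +
        (2 : ℂ) • ((numberOp x 0 * numberOp x 1 + numberOp y 0 * numberOp y 1 :
          Matrix (Finset (Orb (FermionTorus 2 L))) (Finset (Orb (FermionTorus 2 L))) ℂ)) +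
        (2 : ℂ) • (siteDensity x * siteDensity y)).PosSemidef := by
  have h := posSemidef_conjTranspose_mul_self
    (((2 : ℝ) : ℂ) • (1 : Matrix (Finset (Orb (FermionTorus 2 L))) (Finset (Orb (FermionTorus 2 L))) ℂ) + ((-1 : ℝ) : ℂ) • siteDensity x +
      ((-1 : ℝ) : ℂ) • siteDensity y)
  rw [conjTranspose_lin L, lin_mul_lin L] at h
  convert h using 1
  push_cast
  module

/-- **Upper two-site bound** `n_x + n_y + 2(d_x + d_y) - 2 n_x n_y = (n_x - n_y)² ⪰ 0`. -/
theorem posSemidef_siteDensity_sub_sq (x y : FermionTorus 2 L) :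
    ((siteDensity x + siteDensity y) +
        (2 : ℂ) • ((numberOp x 0 * numberOp x 1 + numberOp y 0 * numberOp y 1 :
          Matrix (Finset (Orb (FermionTorus 2 L))) (Finset (Orb (FermionTorus 2 L))) ℂ)) -
        (2 : ℂ) • (siteDensity x * siteDensity y)).PosSemidef := by
  have h := posSemidef_conjTranspose_mul_self
    (((0 : ℝ) : ℂ) • (1 : Matrix (Finset (Orb (FermionTorus 2 L))) (Finset (Orb (FermionTorus 2 L))) ℂ) + ((1 : ℝ) : ℂ) • siteDensity x +
      ((-1 : ℝ) : ℂ) • siteDensity y)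
  rw [conjTranspose_lin L, lin_mul_lin L] at h
  convert h using 1
  push_cast
  module

end TwoSite

section Torus

variable (L : ℕ) [NeZero L]

/-- `Σ_x n_{x+r} = Σ_x n_x` on the torus. -/
private theorem sum_siteDensity_add_right (r : TorusSite 2 L) :
    ∑ x : TorusSite 2 L, siteDensity (ofTorusSite (x + r)) =
      ∑ x : TorusSite 2 L, (siteDensity (ofTorusSite x) :
        Matrix (Finset (Orb (FermionTorus 2 L))) (Finset (Orb (FermionTorus 2 L))) ℂ) :=
  Fintype.sum_equiv (Equiv.addRight r) _ _ fun _ => rfl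

/-- `Σ_x d_{x+r} = Σ_x d_x` on the torus. -/
private theorem sum_docc_add_right (r : TorusSite 2 L) :
    ∑ x : TorusSite 2 L, (numberOp (ofTorusSite (x + r)) 0 * numberOp (ofTorusSite (x + r)) 1 :
        Matrix (Finset (Orb (FermionTorus 2 L))) (Finset (Orb (FermionTorus 2 L))) ℂ) =
      ∑ x : TorusSite 2 L, (numberOp (ofTorusSite x) 0 * numberOp (ofTorusSite x) 1 :
        Matrix (Finset (Orb (FermionTorus 2 L))) (Finset (Orb (FermionTorus 2 L))) ℂ) :=
  Fintype.sum_equiv (Equiv.addRight r) _ _ fun _ => rfl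

/-- `|T_L| = L²`. -/
private theorem card_torusSite_sq : Fintype.card (TorusSite 2 L) = L ^ 2 := by
  simp [TorusSite, ZMod.card]

omit [NeZero L] in
/-- `expect` is additive: `⟨ψ, (A - B) ψ⟩ = ⟨ψ, A ψ⟩ - ⟨ψ, B ψ⟩`. -/
private theorem expect_sub' (A B : Matrix (Finset (Orb (FermionTorus 2 L))) (Finset (Orb (FermionTorus 2 L))) ℂ)
    (ψ : Fock (Orb (FermionTorus 2 L))) : expect (A - B) ψ = expect A ψ - expect B ψ := by
  simp [expect, sub_mulVec, dotProduct_sub]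

omit [NeZero L] in
/-- PSD ⇒ nonnegative real expectation. -/
private theorem re_expect_nonneg_of_posSemidef'
    {P : Matrix (Finset (Orb (FermionTorus 2 L))) (Finset (Orb (FermionTorus 2 L))) ℂ}
    (hP : P.PosSemidef) (ψ : Fock (Orb (FermionTorus 2 L))) : 0 ≤ (expect P ψ).re := by
  obtain ⟨hre, -⟩ := Complex.nonneg_iff.mp (hP.dotProduct_mulVec_nonneg ψ)
  simpa [expect] using hre

/-- **Lower operator bound on the torus**: `4L²·1 - 6 Σ_x n_x + 4 Σ_x d_x + 2 N_r ⪰ 0`. -/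
theorem posSemidef_densityCorrSum_lower (r : TorusSite 2 L) :
    ((4 * (L : ℂ) ^ 2) • (1 : Matrix (Finset (Orb (FermionTorus 2 L))) (Finset (Orb (FermionTorus 2 L))) ℂ) -
        (6 : ℂ) • ∑ x : TorusSite 2 L, siteDensity (ofTorusSite x) +
        (4 : ℂ) • ∑ x : TorusSite 2 L, (numberOp (ofTorusSite x) 0 * numberOp (ofTorusSite x) 1 :
          Matrix (Finset (Orb (FermionTorus 2 L))) (Finset (Orb (FermionTorus 2 L))) ℂ) +
        (2 : ℂ) • densityCorrSum L r).PosSemidef := by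
  have h := posSemidef_finset_sum (Finset.univ : Finset (TorusSite 2 L)) fun x _ =>
    posSemidef_two_sub_siteDensity_sq L (ofTorusSite x) (ofTorusSite (x + r))
  simp only [smul_add, Finset.sum_add_distrib, Finset.sum_sub_distrib, ← Finset.smul_sum,
    sum_siteDensity_add_right L, sum_docc_add_right L] at h
  rw [Finset.sum_const, Finset.card_univ, card_torusSite_sq L, ← Nat.cast_smul_eq_nsmul ℂ, smul_smul] at h
  push_cast at h
  convert h using 1
  rw [densityCorrSum]
  module

/-- **Upper operator bound on the torus**: `2 Σ_x n_x + 4 Σ_x d_x - 2 N_r ⪰ 0`. -/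
theorem posSemidef_densityCorrSum_upper (r : TorusSite 2 L) :
    ((2 : ℂ) • ∑ x : TorusSite 2 L, siteDensity (ofTorusSite x) +
        (4 : ℂ) • ∑ x : TorusSite 2 L, (numberOp (ofTorusSite x) 0 * numberOp (ofTorusSite x) 1 :
          Matrix (Finset (Orb (FermionTorus 2 L))) (Finset (Orb (FermionTorus 2 L))) ℂ) -
        (2 : ℂ) • densityCorrSum L r).PosSemidef := by
  have h := posSemidef_finset_sum (Finset.univ : Finset (TorusSite 2 L)) fun x _ =>
    posSemidef_siteDensity_sub_sq L (ofTorusSite x) (ofTorusSite (x + r))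
  simp only [smul_add, Finset.sum_add_distrib, Finset.sum_sub_distrib, ← Finset.smul_sum,
    sum_siteDensity_add_right L, sum_docc_add_right L] at h
  convert h using 1
  rw [densityCorrSum]
  module

/-- **The certificate-free range of `C_c(r; ψ)` on a unit `N`-particle vector** (any `r`):
`(3N - 2𝒟)/L² - 2 ≤ C_c(r; ψ) ≤ (N + 2𝒟)/L²`, `𝒟 = Re⟨ψ, Σ_x n_{x↑}n_{x↓} ψ⟩`. -/
theorem densityCorr_mem_Icc_of_isNParticle (r : TorusSite 2 L) {N : ℕ}
    {ψ : Fock (Orb (FermionTorus 2 L))} (hψ : IsNParticle N ψ) (hnorm : star ψ ⬝ᵥ ψ = 1) :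
    densityCorr L r ψ ∈ Set.Icc
      ((3 * (N : ℝ) - 2 * (expect (∑ x : TorusSite 2 L, (numberOp (ofTorusSite x) 0 * numberOp (ofTorusSite x) 1 :
          Matrix (Finset (Orb (FermionTorus 2 L))) (Finset (Orb (FermionTorus 2 L))) ℂ)) ψ).re) / (L : ℝ) ^ 2 - 2)
      (((N : ℝ) + 2 * (expect (∑ x : TorusSite 2 L, (numberOp (ofTorusSite x) 0 * numberOp (ofTorusSite x) 1 :
          Matrix (Finset (Orb (FermionTorus 2 L))) (Finset (Orb (FermionTorus 2 L))) ℂ)) ψ).re) / (L : ℝ) ^ 2) := by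
  have hL : (0 : ℝ) < (L : ℝ) ^ 2 := by
    have : (0 : ℝ) < (L : ℝ) := by exact_mod_cast Nat.pos_of_ne_zero (NeZero.ne L)
    positivity
  have hN := re_expect_sum_siteDensity_of_isNParticle L hψ
  rw [hnorm, Complex.one_re, mul_one] at hN
  have h1 := re_expect_nonneg_of_posSemidef' L (posSemidef_densityCorrSum_lower L r) ψ
  have h2 := re_expect_nonneg_of_posSemidef' L (posSemidef_densityCorrSum_upper L r) ψ
  rw [expect_add, expect_add, expect_sub' L, expect_smul, expect_smul, expect_smul, expect_smul,
    Complex.add_re, Complex.add_re, Complex.sub_re,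
    show (4 * (L : ℂ) ^ 2) = ((4 * (L : ℝ) ^ 2 : ℝ) : ℂ) by push_cast; ring,
    show (6 : ℂ) = ((6 : ℝ) : ℂ) by norm_num, show (4 : ℂ) = ((4 : ℝ) : ℂ) by norm_num,
    show (2 : ℂ) = ((2 : ℝ) : ℂ) by norm_num,
    Complex.re_ofReal_mul, Complex.re_ofReal_mul, Complex.re_ofReal_mul, Complex.re_ofReal_mul, hN] at h1
  rw [expect_sub' L, expect_add, expect_smul, expect_smul, expect_smul, Complex.sub_re, Complex.add_re,
    show (4 : ℂ) = ((4 : ℝ) : ℂ) by norm_num, show (2 : ℂ) = ((2 : ℝ) : ℂ) by norm_num,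
    Complex.re_ofReal_mul, Complex.re_ofReal_mul, Complex.re_ofReal_mul, hN] at h2
  have hone : (expect (1 : Matrix (Finset (Orb (FermionTorus 2 L))) (Finset (Orb (FermionTorus 2 L))) ℂ) ψ).re = 1 := by
    simp [expect, hnorm]
  rw [hone] at h1
  unfold densityCorr
  constructor
  · rw [sub_le_iff_le_add, div_le_iff₀ hL, add_mul, div_mul_cancel₀ _ hL.ne']
    linarith
  · rw [div_le_div_iff_of_pos_right hL]
    linarith

end Torus

end Summit.Ventures.CertifiedManyBodySolver.Observables
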